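import Mathlib
import Literature.Computability.AlgebraicComplexity.StandardFamilies
import Summits.ValiantsHypothesis.ValiantsHypothesis.Theorems.ValuativeGCTValuativeFlipPermanentDP
import Summits.ValiantsHypothesis.ValiantsHypothesis.Theorems.ValuativeGCTValuativeFlipPencilRankCertificates
import Summits.ValiantsHypothesis.ValiantsHypothesis.Theorems.ValuativeGCTValuativeFlipPencilBorderTools

/-!
# Evaluation certificates for the four-row pencil rank, I: data, values, the verified value table

Helper file (`--supports stmt-ValiantsHypothesis-12624`) for crux `ValuativeGCT.ValuativeFlip`, line
`four-row-count` (`Cruxes/ValuativeFlip/Lines/four_row_count.lean`), wall-breaker axis k14 "small cases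
certified".  The head stub `stub_fourRowPencilRank` is, by `frt_finrank_fourRowSpan_ge` /
`fourRowPencilRank_of_pencilCertificate` (`Theorems/ValuativeGCTValuativeFlipFourRowTransfer.lean`), a
lower bound for `finrank span{X_t · (∂_{kl} per_N)(M·X) : t < 4, k, l < N}` for ONE four-variable pencil
`M` per inner size `N`.  For a FIXED `N` this is a finite computation; this file and its sequel
(`…PencilEvalCheck.lean`) make it a kernel-meaningful one, run under `native_decide` in the instances files.

* the certificate data are formulas, not tables: a prime `certP`, an integer pencil `pencilZ n` of size
  `N = n + 1` (cells `(0,0..3)` carry the unit vectors, the rest pseudo-random digits in `[-3, 3]`) and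
  integer points `pointZ b ∈ [-504, 504]⁴` (both `irreducible_def`: the kernel never unfolds the
  big-literal arithmetic, the compiler evaluates it);
* `aeval_member_eq_cast` — the value of the member `(t, k, l)` at the point `y` is the INTEGER
  `memberValZ = y_t · per (A(y)^{(k,l)})`, `A(y)_{ij} = Σ_s pencilZ (i,j) s · y_s` (`pb_aeval_pderiv_perPoly`);
* `valP` / `valP_eq_cast` — the same value modulo `certP` as computed by the verified subset DP of
  `Theorems/ValuativeGCTValuativeFlipPermanentDP.lean` (`PTbl.get_dpF_succAbove`, `permanent_map`);
* `PTbl.dpFM` — the same DP on `ℕ` with reductions modulo `p` (what actually runs) and its agreement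
  with `PTbl.dpF` over `ZMod p` (`PTbl.map_dpFM`, `natCast_get_dpFM`);
* `valTable n P` — the value table (`P` points × `4(n+1)²` members, one batch of `n + 1` DP trees per
  point) and its spec `valTable_get`: `((valTable n P)[b][μ] : ZMod certP) = valP n (pointZ b) (member μ)`.

Executable-code discipline (learned the hard way): no definition returns a function closing over an
expensive `let` — tables are arrays, matrices over them are trivial accessors (`matOfArr`).
[folklore; von zur Gathen 1987 §2 (`∂per = permanental minor`); this crux's
`…PencilRankCertificates.lean` (certificate formats)]
-/

set_option linter.dupNamespace false

namespace Summit.ValiantsHypothesis.ValiantsHypothesis.Theorems.ValuativeFlip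

open MvPolynomial
open scoped BigOperators Matrix
open Literature.Computability.AlgebraicComplexity

/-! ## Certificate data (formulas) -/

/-- The modulus of the certificates (a prime; only `1 < certP` is used in proofs). [folklore] -/
def certP : ℕ := 1000003

/-- `1 < certP`, so `ZMod certP` is nontrivial. [folklore] -/
instance certP_fact : Fact (1 < certP) := ⟨by unfold certP; norm_num⟩

/-- `certP ≠ 0`. [folklore] -/
instance certP_neZero : NeZero certP := ⟨by unfold certP; norm_num⟩

/-- The integer pencil of size `n + 1`: cell `(i, j)`, coefficient of `X_t`.  Cells `(0, 0..3)` carry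
the unit vectors `e_0..e_3` (so `frt_finrank_fourRowSpan_ge` applies with `c t = (0, t)`); all other
cells carry pseudo-random digits in `[-3, 3]`.  (`irreducible_def`: the kernel must never unfold
the big-literal arithmetic on symbolic arguments; the compiler still evaluates it.) [folklore] -/
irreducible_def pencilZ (n : ℕ) (ij : Fin (n + 1) × Fin (n + 1)) (t : Fin 4) : ℤ :=
  if (ij.1 : ℕ) = 0 ∧ (ij.2 : ℕ) < 4 then (if (ij.2 : ℕ) = (t : ℕ) then 1 else 0)
  else
    let x : ℕ := (t : ℕ) * (n + 1) * (n + 1) + (ij.1 : ℕ) * (n + 1) + (ij.2 : ℕ) + 1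
    ((((x * x * 7919 + x * 104729 + 13) % 1000003) % 7 : ℕ) : ℤ) - 3

/-- The integer evaluation points `pointZ b ∈ [-504, 504]⁴`, `b ∈ ℕ` (pseudo-random; `irreducible_def`
for the same reason). [folklore] -/
irreducible_def pointZ (b : ℕ) (t : Fin 4) : ℤ :=
  let x : ℕ := 4 * b + (t : ℕ) + 1
  ((((x * x * 48611 + x * 15485863 + 7) % 999983) % 1009 : ℕ) : ℤ) - 504

/-- The integer matrix `A(y)_{ij} = Σ_t pencilZ (i,j) t · y_t` (the pencil evaluated at `y`). [folklore] -/
def pencilMatZ (n : ℕ) (y : Fin 4 → ℤ) : Matrix (Fin (n + 1)) (Fin (n + 1)) ℤ :=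
  Matrix.of fun i j => ∑ t : Fin 4, pencilZ n (i, j) t * y t

/-- The INTEGER value of the member `(t, (k, l))` at the point `y`: `y_t · per (A(y)^{(k,l)})`.
[von zur Gathen 1987 §2; folklore] -/
def memberValZ (n : ℕ) (y : Fin 4 → ℤ) (tc : Fin 4 × (Fin (n + 1) × Fin (n + 1))) : ℤ :=
  y tc.1 * ((pencilMatZ n y).submatrix tc.2.1.succAbove tc.2.2.succAbove).permanent

/-- **The family evaluates to integers.**  Evaluating the member `X_t · (∂_{kl} per)(M·X)` of the
pencil family (`M = pencilZ n` cast to `ℂ`, the family of `frt_finrank_fourRowSpan_ge`) at the integer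
point `y` gives `memberValZ n y (t,(k,l))`. [von zur Gathen 1987 §2 (`pb_aeval_pderiv_perPoly`);
folklore] -/
theorem aeval_member_eq_cast (n : ℕ) (y : Fin 4 → ℤ) (tc : Fin 4 × (Fin (n + 1) × Fin (n + 1))) :
    MvPolynomial.aeval (fun s : Fin 4 => ((y s : ℤ) : ℂ))
      ((X tc.1 : MvPolynomial (Fin 4) ℂ) *
        aeval (fun ij : Fin (n + 1) × Fin (n + 1) =>
          ∑ t : Fin 4, (fun ij t => ((pencilZ n ij t : ℤ) : ℂ)) ij t • (X t : MvPolynomial (Fin 4) ℂ))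
          (pderiv tc.2 (perPoly (Fin (n + 1)) ℂ))) = ((memberValZ n y tc : ℤ) : ℂ) := by
  obtain ⟨t, k, l⟩ := tc
  rw [map_mul, aeval_X, ← AlgHom.comp_apply, MvPolynomial.comp_aeval, pb_aeval_pderiv_perPoly]
  simp only [memberValZ, Int.cast_mul]
  congr 1
  rw [← eq_intCast (Int.castRingHom ℂ), ← permanent_map, ← Matrix.submatrix_map]
  congr 1
  ext i j
  simp [pencilMatZ, map_sum, mul_comm]

/-! ## The modular evaluation: spec over `ZMod certP` (verified DP) -/

/-- The pencil evaluated at `y`, modulo `certP`. [folklore] -/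
def pencilMatP (n : ℕ) (y : Fin 4 → ℤ) : Matrix (Fin (n + 1)) (Fin (n + 1)) (ZMod certP) :=
  (pencilMatZ n y).map (Int.castRingHom (ZMod certP))

/-- SPEC of the modular value of member `(t,(k,l))` at `y`: `y_t` times the DP-evaluated permanental
minor modulo `certP`. [folklore] -/
def valP (n : ℕ) (y : Fin 4 → ℤ) (tc : Fin 4 × (Fin (n + 1) × Fin (n + 1))) : ZMod certP :=
  ((y tc.1 : ℤ) : ZMod certP) *
    PTbl.get (PTbl.dpF n (fun x : Fin n => pencilMatP n y (tc.2.1.succAbove x)))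
      (PTbl.ind (Finset.univ.erase tc.2.2))

/-- The modular value is the integer value reduced modulo `certP` (`PTbl.get_dpF_succAbove`,
`permanent_map`). [folklore] -/
theorem valP_eq_cast (n : ℕ) (y : Fin 4 → ℤ) (tc : Fin 4 × (Fin (n + 1) × Fin (n + 1))) :
    valP n y tc = (Int.castRingHom (ZMod certP)) (memberValZ n y tc) := by
  rw [valP, PTbl.get_dpF_succAbove, memberValZ, map_mul, ← permanent_map, ← Matrix.submatrix_map,
    eq_intCast]
  rfl

/-! ## The same DP on natural numbers reduced modulo `p` (what actually runs), and its agreement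
with the spec through `Nat.cast : ℕ → ZMod p` -/

namespace PTbl

/-- Map a function over all entries of a table. [folklore] -/
def map {R S : Type*} (g : R → S) : {d : ℕ} → PTbl R d → PTbl S d
  | 0, leaf v => leaf (g v)
  | _ + 1, node t0 t1 => node (map g t0) (map g t1)

/-- Lookup commutes with `map`. [folklore] -/
theorem get_map {R S : Type*} (g : R → S) :
    ∀ {d : ℕ} (t : PTbl R d) (f : Fin d → Bool), get (map g t) f = g (get t f)
  | 0, leaf v, _ => rfl
  | _ + 1, node t0 t1, f => by
      simp only [map, get_node, get_map g t0, get_map g t1]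
      split <;> rfl

/-- Pointwise sum modulo `p`. [folklore] -/
def addM (p : ℕ) : {d : ℕ} → PTbl ℕ d → PTbl ℕ d → PTbl ℕ d
  | 0, leaf v, leaf w => leaf ((v + w) % p)
  | _ + 1, node a b, node c e => node (addM p a c) (addM p b e)

/-- Pointwise scalar multiple modulo `p`. [folklore] -/
def smulM (p x : ℕ) : {d : ℕ} → PTbl ℕ d → PTbl ℕ d
  | 0, leaf v => leaf (x * v % p)
  | _ + 1, node a b => node (smulM p x a) (smulM p x b)

/-- One Laplace row modulo `p` (same recursion as `step`). [folklore] -/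
def stepM (p : ℕ) : {d : ℕ} → (Fin d → ℕ) → PTbl ℕ d → PTbl ℕ d
  | 0, _, leaf _ => leaf 0
  | _ + 1, a, node t0 t1 =>
      node (stepM p (Fin.tail a) t0) (addM p (smulM p (a 0) t0) (stepM p (Fin.tail a) t1))

/-- The permanent DP modulo `p` (same recursion as `dpF`). [folklore] -/
def dpFM (p : ℕ) {d : ℕ} : (L : ℕ) → (Fin L → Fin d → ℕ) → PTbl ℕ d
  | 0, _ => init d
  | L + 1, rows => stepM p (rows 0) (dpFM p L (Fin.tail rows))

/-- `map` of the zero table. [folklore] -/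
theorem map_zero_natCast (p : ℕ) : ∀ d : ℕ, map (Nat.cast : ℕ → ZMod p) (zero d) = zero d
  | 0 => by simp only [zero, map, Nat.cast_zero]
  | d + 1 => by simp only [zero, map, map_zero_natCast p d]

/-- `map` of the start table. [folklore] -/
theorem map_init_natCast (p : ℕ) : ∀ d : ℕ, map (Nat.cast : ℕ → ZMod p) (init d) = init d
  | 0 => by simp only [init, map, Nat.cast_one]
  | d + 1 => by simp only [init, map, map_init_natCast p d, map_zero_natCast]

/-- `addM` is `add` after casting to `ZMod p`. [folklore] -/
theorem map_addM (p : ℕ) : ∀ {d : ℕ} (s t : PTbl ℕ d),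
    map (Nat.cast : ℕ → ZMod p) (addM p s t) = add (map Nat.cast s) (map Nat.cast t)
  | 0, leaf v, leaf w => by simp only [addM, add, map, ZMod.natCast_mod, Nat.cast_add]
  | _ + 1, node a b, node c e => by simp only [addM, add, map, map_addM p a c, map_addM p b e]

/-- `smulM` is `smul` after casting to `ZMod p`. [folklore] -/
theorem map_smulM (p x : ℕ) : ∀ {d : ℕ} (t : PTbl ℕ d),
    map (Nat.cast : ℕ → ZMod p) (smulM p x t) = smul (x : ZMod p) (map Nat.cast t)
  | 0, leaf v => by simp only [smulM, smul, map, ZMod.natCast_mod, Nat.cast_mul]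
  | _ + 1, node a b => by simp only [smulM, smul, map, map_smulM p x a, map_smulM p x b]

/-- `stepM` is `step` after casting to `ZMod p`. [folklore] -/
theorem map_stepM (p : ℕ) : ∀ {d : ℕ} (a : Fin d → ℕ) (t : PTbl ℕ d),
    map (Nat.cast : ℕ → ZMod p) (stepM p a t) = step (fun i => (a i : ZMod p)) (map Nat.cast t)
  | 0, a, leaf v => by simp only [stepM, step, map, Nat.cast_zero]
  | _ + 1, a, node t0 t1 => by
      simp only [stepM, step, map, map_addM, map_smulM, map_stepM p (Fin.tail a)]
      rfl

/-- `dpFM` is `dpF` after casting to `ZMod p`. [folklore] -/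
theorem map_dpFM (p : ℕ) {d : ℕ} : ∀ (L : ℕ) (rows : Fin L → Fin d → ℕ),
    map (Nat.cast : ℕ → ZMod p) (dpFM p L rows) = dpF L (fun x i => (rows x i : ZMod p))
  | 0, rows => by simp only [dpFM, dpF, map_init_natCast]
  | L + 1, rows => by
      simp only [dpFM, dpF, map_stepM, map_dpFM p L (Fin.tail rows)]
      rfl

end PTbl

/-- The pencil evaluated at `y`, entries reduced into `[0, certP)` as natural numbers. [folklore] -/
def pencilMatN (n : ℕ) (y : Fin 4 → ℤ) : Matrix (Fin (n + 1)) (Fin (n + 1)) ℕ :=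
  Matrix.of fun i j => ((pencilMatZ n y i j) % (certP : ℤ)).toNat

/-- Reducing an integer into `[0, certP)` and casting agrees with the integer cast. [folklore] -/
theorem natCast_toNat_emod (z : ℤ) : ((z % (certP : ℤ)).toNat : ZMod certP) = (z : ZMod certP) := by
  have h0 : (0 : ℤ) ≤ z % (certP : ℤ) := Int.emod_nonneg z (by exact_mod_cast (NeZero.ne certP))
  have h1 : (((z % (certP : ℤ)).toNat : ℤ) : ZMod certP) = ((z % (certP : ℤ) : ℤ) : ZMod certP) := by
    rw [Int.toNat_of_nonneg h0]
  rw [Int.cast_natCast] at h1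
  rw [h1, ZMod.intCast_mod]

/-- `pencilMatN` casts to `pencilMatP`. [folklore] -/
theorem natCast_pencilMatN (n : ℕ) (y : Fin 4 → ℤ) (i j : Fin (n + 1)) :
    ((pencilMatN n y i j : ℕ) : ZMod certP) = pencilMatP n y i j := by
  simp only [pencilMatN, pencilMatP, Matrix.of_apply, Matrix.map_apply, natCast_toNat_emod,
    eq_intCast]

/-! ## Fast (materialised) evaluation on `ℕ`, provably the spec after casting

Executable-code discipline: no definition below returns a function closing over an expensive `let`
(the compiler may re-enter such a body at every entry access); tables are passed around as arrays and
matrices over them are trivial accessors. -/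

/-- Accessor: an array read as an `a × b` matrix through `finProdFinEquiv`. [folklore] -/
def matOfArr {α : Type*} [Inhabited α] (a b : ℕ) (arr : Array α) : Matrix (Fin a) (Fin b) α :=
  Matrix.of fun i j => arr.getD ((finProdFinEquiv (i, j) : Fin (a * b)) : ℕ) default

/-- A matrix laid out as an array through `finProdFinEquiv`. [folklore] -/
def arrOfMat {α : Type*} {a b : ℕ} (A : Matrix (Fin a) (Fin b) α) : Array α :=
  Array.ofFn fun q : Fin (a * b) => A (finProdFinEquiv.symm q).1 (finProdFinEquiv.symm q).2

/-- In range, `Array.getD` is the element. [folklore] -/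
theorem array_getD_of_lt {α : Type*} (arr : Array α) (i : ℕ) (d : α) (h : i < arr.size) :
    arr.getD i d = arr[i] := by
  unfold Array.getD
  rw [dif_pos h]
  rfl

/-- `matOfArr (arrOfMat A) = A`. [folklore] -/
theorem matOfArr_arrOfMat {α : Type*} [Inhabited α] {a b : ℕ} (A : Matrix (Fin a) (Fin b) α) :
    matOfArr a b (arrOfMat A) = A := by
  ext i j
  unfold matOfArr arrOfMat
  have h : ((finProdFinEquiv (i, j) : Fin (a * b)) : ℕ) < (Array.ofFn fun q : Fin (a * b) =>
      A (finProdFinEquiv.symm q).1 (finProdFinEquiv.symm q).2).size := by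
    rw [Array.size_ofFn]; exact (finProdFinEquiv (i, j)).2
  rw [Matrix.of_apply, array_getD_of_lt _ _ _ h, Array.getElem_ofFn]
  simp only [Fin.eta, Equiv.symm_apply_apply]

/-- Member codes: `Fin 4 × (Fin (n+1) × Fin (n+1)) ≃ Fin (4 · (n+1)²)`. [folklore] -/
def memberEquiv (n : ℕ) : Fin 4 × (Fin (n + 1) × Fin (n + 1)) ≃ Fin (4 * ((n + 1) * (n + 1))) :=
  (Equiv.prodCongr (Equiv.refl (Fin 4)) finProdFinEquiv).trans finProdFinEquiv

/-- FAST value table on `ℕ`: `(valTable n P)[b][μ]` = value modulo `certP` of the member with code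
`μ` at the point `pointZ b`, all `4(n+1)²` members of one point sharing the `n + 1` DP trees (one per
deleted row), computed by `dpFM` on `ℕ`. [folklore] -/
def valTable (n P : ℕ) : Array (Array ℕ) :=
  Array.ofFn fun b : Fin P =>
    let y : Fin 4 → ℤ := fun t => pointZ b t
    let yN : Fin 4 → ℕ := fun t => ((y t) % (certP : ℤ)).toNat
    let A : Matrix (Fin (n + 1)) (Fin (n + 1)) ℕ := matOfArr (n + 1) (n + 1) (arrOfMat (pencilMatN n y))
    let trees : Array (PTbl ℕ (n + 1)) :=
      Array.ofFn fun k : Fin (n + 1) => PTbl.dpFM certP n (fun x : Fin n => A (k.succAbove x))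
    Array.ofFn fun μ : Fin (4 * ((n + 1) * (n + 1))) =>
      yN ((memberEquiv n).symm μ).1 *
        PTbl.get (trees[((((memberEquiv n).symm μ).2.1 : Fin (n + 1)) : ℕ)]'(by
            simp only [trees, Array.size_ofFn]; exact (((memberEquiv n).symm μ).2.1).2))
          (fun i => decide (i ≠ ((memberEquiv n).symm μ).2.2)) % certP

/-- Size of the value table. [folklore] -/
theorem size_valTable (n P : ℕ) : (valTable n P).size = P := by
  simp only [valTable, Array.size_ofFn]

/-- Size of a column of the value table. [folklore] -/
theorem size_valTable_get (n P : ℕ) (b : ℕ) (hb : b < (valTable n P).size) :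
    ((valTable n P)[b]).size = 4 * ((n + 1) * (n + 1)) := by
  simp only [valTable, Array.getElem_ofFn, Array.size_ofFn]

/-- The `ℕ`-DP read modulo `certP` is the `ZMod certP`-DP (`PTbl.map_dpFM`, `PTbl.get_map`). [folklore] -/
theorem natCast_get_dpFM {L d : ℕ} (rows : Fin L → Fin d → ℕ) (f : Fin d → Bool) :
    ((PTbl.get (PTbl.dpFM certP L rows) f : ℕ) : ZMod certP) =
      PTbl.get (PTbl.dpF L (fun x i => (rows x i : ZMod certP))) f := by
  rw [← PTbl.get_map (Nat.cast : ℕ → ZMod certP), PTbl.map_dpFM]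

/-- The lookup key of `univ ∖ {l}`. [folklore] -/
theorem PTbl.ind_univ_erase {d : ℕ} (l : Fin d) :
    PTbl.ind (Finset.univ.erase l) = fun i => decide (i ≠ l) := by
  funext i
  simp [PTbl.ind]

/-- **The fast table is the spec**: `((valTable n P)[b][μ] : ZMod certP) = valP n (pointZ b) (member μ)`
(`natCast_get_dpFM`, `natCast_pencilMatN`). [folklore] -/
theorem valTable_get (n P : ℕ) (b : ℕ) (hb : b < (valTable n P).size) (μ : ℕ)
    (hμ : μ < ((valTable n P)[b]).size) :
    ((((valTable n P)[b])[μ] : ℕ) : ZMod certP) = valP n (fun t => pointZ b t)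
      ((memberEquiv n).symm ⟨μ, by rwa [size_valTable_get] at hμ⟩) := by
  simp only [valTable, Array.getElem_ofFn, matOfArr_arrOfMat, valP, ZMod.natCast_mod, Nat.cast_mul,
    natCast_toNat_emod, natCast_get_dpFM, natCast_pencilMatN, PTbl.ind_univ_erase]

end Summit.ValiantsHypothesis.ValiantsHypothesis.Theorems.ValuativeFlip
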